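import Literature.AlgebraicGeometry.HodgeTheory.SaitoGrFDeRhamCurveNetProofs
import Literature.AlgebraicGeometry.HodgeTheory.HodgeStructureOfHodgeModelSubHodge
import HarnessLib

/-!
# The classical anchor of a curve net: `curveNetSaitoData_nonempty` from polarised Hodge
# structures on `H^{m+1}(X̃(ℂ); ℚ)` whose kernels of restriction to Zariski opens are sub-Hodge
# structures

Family `hodge`, layer `Literature/AlgebraicGeometry/HodgeTheory`. Third file of the story
`SaitoGrFDeRhamCurveNet` (the named fact `curveNetSaitoData_nonempty`: for a curve net
`N : Motives.CurveNet m X` over `ℂ`, `2 ≤ m`, Saito's graded de Rham package of `IC(R¹π_*ℚ)` anchored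
to the cohomology of the total space `X̃ = N.total` exists) and `SaitoGrFDeRhamCurveNetProofs`
(PROVED there: the fact is equivalent to the existence of ANCHORS `CurveNetHodgeAnchor N` — a
finite-dimensional polarizable pure `ℚ`-Hodge structure `I` of weight `m + 1` with sub-Hodge
structures of supports and comparison maps `ρ_F : H^{m+1}(X̃(ℂ); ℂ) → I_ℂ/(I_{V(F)})_ℂ` tied to the
real carriers `complexBetti`, `classesSupportedOn`, `IsRationalClass`, `IsInHodgeFiltration`).

This file carries out, ON THE TREE'S CARRIERS, the classical construction of an anchor recorded in
the module docstring of `SaitoGrFDeRhamCurveNetProofs` ("classically `I = H^{m+1}(X̃; ℚ)` itself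
with `I_T = ker (H^{m+1}(X̃) → H^{m+1}(X̃ ∖ π⁻¹T̄))` qualifies"): it PROVES the named fact from the
classical Hodge-theoretic inputs it quotes, taken as hypotheses stated on the rational singular
cohomology `H^{m+1}(X̃(ℂ); ℚ) = Motives.bettiCohomology N.total (m + 1)` (the convention of
`GysinHodgeClassLiftProofs`, `RelativeCohomologyMHS`, `Motives.BettiHodgeData`) —

* (H1) a pure `ℚ`-Hodge structure `HX` of weight `m + 1` on `H^{m+1}(X̃(ℂ); ℚ)` (the Hodge
  decomposition of the compact Kähler manifold `X̃(ℂ)`: Voisin, *Hodge Theory and Complex Algebraic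
  Geometry I* (2002), Thm. 6.18, §7.1.1; in the tree: named facts `nonempty_hodgeModel`,
  `hodgePQ_independent_of_hodgeModel`, `exists_isReal_hodgeModel`);
* (H2) `HX` is polarizable (Lefschetz decomposition and Hodge–Riemann bilinear relations, ibid.
  Thm. 6.32 and §7.1.2);
* (H3) `HX` induces the tree's Hodge filtration: a class `c ∈ H^{m+1}(X̃(ℂ); ℂ)` lying in `Fʳ`
  for some Hodge model of `X̃` (`IsInHodgeFiltration`) lies in the image of `Fʳ HX_ℂ` under the
  complexification `β : H^{m+1}(X̃(ℂ); ℚ) ⊗ ℂ → H^{m+1}(X̃(ℂ); ℂ)` of the change of coefficients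
  (ibid. §7.1.1: "`Hᵏ(X, ℤ) ⊗ ℂ = Hᵏ(X, ℂ)`" carries the Hodge filtration; all Hodge models induce
  the same filtration, module docstring of `RationalHodgeClasses`);
* (H4) for every Zariski-closed `Z ⊆ X̃`, the kernel of the restriction
  `H^{m+1}(X̃(ℂ); ℚ) → H^{m+1}((X̃ ∖ Z)(ℂ); ℚ)` underlies a sub-Hodge structure of `HX` (Deligne,
  *Théorie de Hodge II* (1971), Cor. 3.2.17–3.2.18: for `U ⊆ X̃` Zariski open the restriction
  `Hⁿ(X̃) → Hⁿ(U)` is a morphism of mixed Hodge structures with image `W_n Hⁿ(U)`, hence strict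
  (ibid. Thm. 2.3.5 (iii)) with kernel a sub-Hodge structure of the pure `Hⁿ(X̃)`) —

none of which is vendored as a named fact here (D-0026): they are hypotheses, to be supplied by
the constructions of the Hodge decomposition, the polarisations and Deligne's mixed Hodge theory
on the tree's carriers. GIVEN them, `CurveNetHodgeAnchor.ofHodgeStructure` is the anchor with
`I := H^{m+1}(X̃(ℂ); ℚ)`, `supported T := ker (H^{m+1}(X̃(ℂ); ℚ) → H^{m+1}((X̃ ∖ π⁻¹T̄)(ℂ); ℚ))`
(`T̄` the Zariski closure, so that supports are sub-Hodge structures for every `T ⊆ ℙᵐ` and agree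
with the classes supported on `π⁻¹V(F)` for hypersurfaces), and
`ρ_F := (I_ℂ → I_ℂ/(I_{V(F)})_ℂ) ∘ β⁻¹`, `β` being an isomorphism for the smooth projective `X̃`
(`β = Motives.ofRatClassBaseChange`, an equivalence `ofRatClassBaseChangeEquiv` for `X̃` smooth
projective, file `ClassesSupportedOnComplexification`: injective for every space, onto because the
rational classes span — universal coefficients, Voisin I §7.1.1). The one computation is
`ker ρ_F = classesSupportedOn X̃ (π⁻¹V(F)) (m+1)`, which is `map_baseChange_ratClassesSupportedOn` of
`ClassesSupportedOnComplexification` (the complex kernel of restriction to `(X̃ ∖ Z)(ℂ)` is the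
complexification of the rational one, by flatness of `ℂ/ℚ`).
The remaining fields are bookkeeping: `ρ_F` is onto, compatible with `V(F) ⊆ V(F·G)`, sends a
rational class `ι(x)` to `[1 ⊗ x]` and a class of `β(Fʳ)` to the class of an element of `Fʳ`.

Main results: `CurveNetHodgeAnchor.ofHodgeStructure` (one curve net, data in degree `m + 1`
only), `nonempty_curveNetSaitoData_of_hodgeStructure` (hence a package `CurveNetSaitoData N`, by
`CurveNetHodgeAnchor.toCurveNetSaitoData`; no hypothesis `2 ≤ m` is needed for this direction) and
`curveNetSaitoData_nonempty_of_hodgeStructures`: **the named fact follows from (H1)–(H4) for the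
cohomology of smooth projective complex varieties in every degree.** Finally, feeding in the Hodge
structure of a Hodge symmetric Hodge model (`HodgeModel.hodgeStructure`, file
`HodgeStructureOfHodgeModel`, which supplies (H1); (H3) and the passage to (H4) are
`HodgeStructureOfHodgeModelSubHodge`),
`curveNetSaitoData_nonempty_of_hodgeModels` / `…_of_exists_isReal_hodgeModel` reduce the named fact
to: the named facts `exists_isReal_hodgeModel` (GAGA, de Rham, Hodge decomposition; a real model is
Hodge symmetric) and `hodgePQ_independent_of_hodgeModel` (all models induce the same filtration),
Deligne's theorem in the complexified per-kernel form `hK` of the barrier catalogue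
(`Literature/Barriers/HodgeConjecture/…KernelSubHodge`: for `Z ⊆ Y` Zariski closed the span of the
rational classes killed by `Hᵏ(Y(ℂ); ℂ) → Hᵏ((Y ∖ Z)(ℂ); ℂ)` is stable under the decomposition into
types — C. Voisin, *Chow Rings …* (2014), Thm. 2.39; deliberately not a named fact, D-0026), and
the polarizability of those Hodge structures (Hodge–Riemann bilinear relations, Voisin I Thm. 6.32;
no carrier-level statement in the tree yet). Everything in this file is a theorem or a definition
with a body; the named fact itself is NOT discharged — what remains is exactly these inputs.

## References

* [VoisinHodgeI2002] C. Voisin, Hodge Theory and Complex Algebraic Geometry I, CUP 2002, Thm. 6.18,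
  Thm. 6.32, §7.1.1, §7.1.2, §7.3.1.
* [DeligneHodgeII1971] P. Deligne, Théorie de Hodge II, Publ. Math. IHÉS 40 (1971), Thm. 2.3.5,
  Cor. 3.2.17–3.2.18.
* [Saito1990] M. Saito, Mixed Hodge modules, Publ. RIMS 26 (1990), Thm. 0.1–0.2, §4.5.
* [HatcherAT2002] A. Hatcher, Algebraic Topology, CUP 2002, §3.1 p. 198 (change of coefficients).
* [GrothendieckTopology1969] A. Grothendieck, Hodge's general conjecture is false for trivial
  reasons, Topology 8 (1969), §1.
* [VoisinChowRings2014] C. Voisin, Chow Rings, Decomposition of the Diagonal, and the Topology of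
  Families, Ann. of Math. Stud. 187 (2014), Thm. 2.39.
-/

noncomputable section

open scoped TensorProduct
open CategoryTheory AlgebraicGeometry
open Literature.AlgebraicTopology.SingularHomology

namespace Literature.AlgebraicGeometry.HodgeTheory

section HodgeTheory

/-! ### The classical anchor of a curve net -/

section Anchor

variable {m : ℕ} {X : Motives.SchemeOver ℂ} (N : Motives.CurveNet m X)

/-- The closed subset `π⁻¹(T̄) ⊆ X̃` over the Zariski closure of `T ⊆ ℙᵐ`. [folklore] -/
def _root_.Literature.AlgebraicGeometry.Motives.CurveNet.preimageClosure
    (T : Set (Motives.projectiveSpace m ℂ).left) : Set N.total.left :=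
  N.proj.left.base ⁻¹' closure T

/-- `π⁻¹(T̄)` is Zariski closed. [folklore] -/
theorem _root_.Literature.AlgebraicGeometry.Motives.CurveNet.isClosed_preimageClosure
    (T : Set (Motives.projectiveSpace m ℂ).left) : IsClosed (N.preimageClosure T) :=
  isClosed_closure.preimage N.proj.left.continuous

/-- `π⁻¹(T̄)` is monotone in `T`. [folklore] -/
theorem _root_.Literature.AlgebraicGeometry.Motives.CurveNet.preimageClosure_mono
    {T T' : Set (Motives.projectiveSpace m ℂ).left} (h : T ⊆ T') :
    N.preimageClosure T ⊆ N.preimageClosure T' :=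
  Set.preimage_mono (closure_mono h)

/-- `π⁻¹(ℙᵐ) = X̃`. [folklore] -/
@[simp]
theorem _root_.Literature.AlgebraicGeometry.Motives.CurveNet.preimageClosure_univ :
    N.preimageClosure Set.univ = Set.univ := by
  rw [Motives.CurveNet.preimageClosure, closure_univ, Set.preimage_univ]

/-- `π⁻¹(∅̄) = ∅`. [folklore] -/
@[simp]
theorem _root_.Literature.AlgebraicGeometry.Motives.CurveNet.preimageClosure_empty :
    N.preimageClosure ∅ = ∅ := by
  rw [Motives.CurveNet.preimageClosure, closure_empty, Set.preimage_empty]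

/-- For a hypersurface, `π⁻¹(V(F)‾) = π⁻¹V(F)` (hypersurfaces are closed). [folklore] -/
theorem _root_.Literature.AlgebraicGeometry.Motives.CurveNet.preimageClosure_projHypersurface
    (F : MvPolynomial (Fin (m + 1)) ℂ) :
    N.preimageClosure (projHypersurface m F) = N.proj.left.base ⁻¹' projHypersurface m F := by
  rw [Motives.CurveNet.preimageClosure, (isClosed_projHypersurface m F).closure_eq]

variable {N}

/-- **The classical anchor of a curve net** (module docstring). Given a pure `ℚ`-Hodge structure
`HX` of weight `m + 1` on `H^{m+1}(X̃(ℂ); ℚ)` (H1), polarizable (H2), inducing the tree's Hodge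
filtration of `X̃` through `β` (H3) and for which the kernels of restriction to the complements of
Zariski-closed subsets are sub-Hodge structures (H4), the anchor `CurveNetHodgeAnchor N` with
`I := H^{m+1}(X̃(ℂ); ℚ)`, `supported T := ker (H^{m+1}(X̃(ℂ); ℚ) → H^{m+1}((X̃ ∖ π⁻¹T̄)(ℂ); ℚ))` and
`ρ_F := (I_ℂ ↠ I_ℂ/(I_{V(F)})_ℂ) ∘ β⁻¹`. Its kernel property `ker ρ_F = classesSupportedOn X̃ (π⁻¹V(F))`
is `map_baseChange_ratClassesSupportedOn`; the other fields are formal.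
[cite: DeligneHodgeII1971, Cor. 3.2.17] [cite: VoisinHodgeI2002, §7.1.1 and §7.1.2]
[cite: Saito1990, Thm. 0.1 and §4.5] -/
def CurveNetHodgeAnchor.ofHodgeStructure
    (HX : Motives.HodgeStructure (Motives.bettiCohomology N.total (m + 1)) ((m : ℤ) + 1))
    (hpol : HX.IsPolarizable)
    (hF : ∀ (r : ℕ) (c : complexBetti N.total (m + 1)),
      IsInHodgeFiltration (m + 1) N.total (m + 1) r c →
        c ∈ (HX.F r).map (Motives.ofRatClassBaseChange (Motives.ComplexPoints N.total) (m + 1)))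
    (hker : ∀ Z : Set N.total.left, IsClosed Z →
      ∃ S : HX.SubHodgeStructure, S.toSubmodule = ratClassesSupportedOn N.total Z (m + 1)) :
    CurveNetHodgeAnchor N where
  I := Motives.bettiCohomology N.total (m + 1)
  finiteDimensional := finiteDimensional_bettiCohomology N.isSmoothProjective_total (m + 1)
  hodge := HX
  isPolarizable := hpol
  supported T := (hker (N.preimageClosure T) (N.isClosed_preimageClosure T)).choose
  supported_mono {T T'} h := by
    rw [(hker (N.preimageClosure T) (N.isClosed_preimageClosure T)).choose_spec,
      (hker (N.preimageClosure T') (N.isClosed_preimageClosure T')).choose_spec]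
    exact ratClassesSupportedOn_mono (N.preimageClosure_mono h) _
  supported_univ := by
    rw [(hker (N.preimageClosure Set.univ) (N.isClosed_preimageClosure _)).choose_spec,
      N.preimageClosure_univ, ratClassesSupportedOn_univ]
  supported_empty := by
    rw [(hker (N.preimageClosure ∅) (N.isClosed_preimageClosure _)).choose_spec,
      N.preimageClosure_empty, ratClassesSupportedOn_empty]
  rho F :=
    ((hker (N.preimageClosure (projHypersurface m F))
        (N.isClosed_preimageClosure _)).choose.toSubmodule.baseChange ℂ).mkQ ∘ₗ
      (ofRatClassBaseChangeEquiv N.isSmoothProjective_total (m + 1)).symm.toLinearMap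
  surjective_rho F _ :=
    (Submodule.mkQ_surjective _).comp
      (ofRatClassBaseChangeEquiv N.isSmoothProjective_total (m + 1)).symm.surjective
  ker_rho F _ := by
    rw [LinearMap.ker_comp, Submodule.ker_mkQ,
      (hker (N.preimageClosure (projHypersurface m F)) (N.isClosed_preimageClosure _)).choose_spec,
      ← Submodule.map_equiv_eq_comap_symm, map_baseChange_ratClassesSupportedOn_equiv,
      N.preimageClosure_projHypersurface]
  rho_mul F G _ _ c y h := by
    rw [LinearMap.comp_apply, Submodule.mkQ_apply, Submodule.Quotient.eq] at h ⊢
    refine Submodule.baseChange_mono (A := ℂ) ?_ h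
    rw [(hker (N.preimageClosure (projHypersurface m F)) (N.isClosed_preimageClosure _)).choose_spec,
      (hker (N.preimageClosure (projHypersurface m (F * G)))
        (N.isClosed_preimageClosure _)).choose_spec]
    exact ratClassesSupportedOn_mono (N.preimageClosure_mono (projHypersurface_subset_mul m F G)) _
  rho_rational F _ c hc := by
    obtain ⟨x, rfl⟩ := (isRationalClass_iff_mem_range_ofRatClass c).1 hc
    refine ⟨x, ?_⟩
    rw [LinearMap.comp_apply, Submodule.mkQ_apply, LinearEquiv.coe_coe,
      ofRatClassBaseChangeEquiv_symm_ofRatClass]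
  rho_hodgeFiltration F _ r c hc := by
    obtain ⟨y, hy, rfl⟩ := hF r c hc
    refine ⟨y, hy, ?_⟩
    rw [LinearMap.comp_apply, Submodule.mkQ_apply, LinearEquiv.coe_coe,
      ← ofRatClassBaseChangeEquiv_apply N.isSmoothProjective_total, LinearEquiv.symm_apply_apply]

/-- Hence, under (H1)–(H4) for the total space `X̃` in degree `m + 1`, **a package
`CurveNetSaitoData N` exists** (the classical anchor extended by the degenerate graded de Rham
data, `CurveNetHodgeAnchor.toCurveNetSaitoData`); no hypothesis on `m` is needed.
[cite: Saito1990, Thm. 0.1–0.2, §2.g and §4.5] [cite: DeligneHodgeII1971, Cor. 3.2.17] -/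
theorem nonempty_curveNetSaitoData_of_hodgeStructure
    (HX : Motives.HodgeStructure (Motives.bettiCohomology N.total (m + 1)) ((m : ℤ) + 1))
    (hpol : HX.IsPolarizable)
    (hF : ∀ (r : ℕ) (c : complexBetti N.total (m + 1)),
      IsInHodgeFiltration (m + 1) N.total (m + 1) r c →
        c ∈ (HX.F r).map (Motives.ofRatClassBaseChange (Motives.ComplexPoints N.total) (m + 1)))
    (hker : ∀ Z : Set N.total.left, IsClosed Z →
      ∃ S : HX.SubHodgeStructure, S.toSubmodule = ratClassesSupportedOn N.total Z (m + 1)) :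
    Nonempty (CurveNetSaitoData N) :=
  ⟨(CurveNetHodgeAnchor.ofHodgeStructure HX hpol hF hker).toCurveNetSaitoData⟩

end Anchor

/-! ### The named fact from the classical inputs in all degrees -/

/-- **`curveNetSaitoData_nonempty` from classical Hodge theory on the tree's carriers.** Suppose
that for every smooth projective complex variety `Y` of dimension `n` and every degree `k` the
rational cohomology `Hᵏ(Y(ℂ); ℚ)` carries a pure `ℚ`-Hodge structure of weight `k` (Hodge
decomposition, Voisin I Thm. 6.18 and §7.1.1) which is polarizable (Hodge–Riemann bilinear
relations and Lefschetz decomposition, ibid. Thm. 6.32, §7.1.2), induces through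
`β : Hᵏ(Y(ℂ); ℚ) ⊗ ℂ ≃ Hᵏ(Y(ℂ); ℂ)` the Hodge filtration of the Hodge models of `Y` (ibid. §7.1.1),
and whose kernels of restriction to the complements of Zariski-closed subsets are sub-Hodge
structures (Deligne, Hodge II, Cor. 3.2.17–3.2.18 with Thm. 2.3.5 (iii)). Then Saito's anchored
package exists for every curve net: the named fact `curveNetSaitoData_nonempty` holds (through
`curveNetSaitoData_nonempty_of_anchor` and the classical anchor). The weight is quantified as
`w = k` to avoid transporting Hodge structures along `((m + 1 : ℕ) : ℤ) = (m : ℤ) + 1`.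
[cite: Saito1990, Thm. 0.1–0.2, §2.g and §4.5] [cite: DeligneHodgeII1971, Cor. 3.2.17]
[cite: VoisinHodgeI2002, Thm. 6.18, Thm. 6.32, §7.1.1 and §7.1.2] -/
theorem curveNetSaitoData_nonempty_of_hodgeStructures
    (h : ∀ ⦃n : ℕ⦄ ⦃Y : Motives.SchemeOver ℂ⦄, Motives.IsSmoothProjective n Y →
      ∀ (k : ℕ) (w : ℤ), w = k →
        ∃ H : Motives.HodgeStructure (Motives.bettiCohomology Y k) w,
          H.IsPolarizable ∧
          (∀ (r : ℕ) (c : complexBetti Y k), IsInHodgeFiltration n Y k r c →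
            c ∈ (H.F r).map (Motives.ofRatClassBaseChange (Motives.ComplexPoints Y) k)) ∧
          ∀ Z : Set Y.left, IsClosed Z →
            ∃ S : H.SubHodgeStructure, S.toSubmodule = ratClassesSupportedOn Y Z k) :
    curveNetSaitoData_nonempty := by
  refine curveNetSaitoData_nonempty_of_anchor fun m X N _ ↦ ?_
  obtain ⟨H, hpol, hF, hker⟩ :=
    h N.isSmoothProjective_total (m + 1) ((m : ℤ) + 1) (by push_cast; ring)
  exact ⟨CurveNetHodgeAnchor.ofHodgeStructure H hpol hF hker⟩

/-! ### The named fact from Hodge models, Deligne's theorem and polarizations -/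

/-- **`curveNetSaitoData_nonempty` from Hodge symmetric Hodge models.** Suppose: every smooth
projective complex variety has a Hodge symmetric Hodge model (`hS`; e.g. a real one,
`exists_isReal_hodgeModel`); all Hodge models induce the same Hodge decomposition (`hI`, the named
fact `hodgePQ_independent_of_hodgeModel`); Deligne's theorem in the complexified per-kernel form of
the barrier catalogue (`hK`: for `Z ⊆ Y` Zariski closed, the span of the rational classes killed by
restriction to `(Y ∖ Z)(ℂ)`, pulled back to any model, is the sum of its intersections with the
`H^{p,q}` — Voisin 2014, Thm. 2.39; Hodge II, Cor. 3.2.17); and the Hodge structures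
`HodgeModel.hodgeStructure` on `Hᵏ(Y(ℂ); ℚ)` so obtained are polarizable (`hpol`; Hodge–Riemann
bilinear relations and Lefschetz decomposition, Voisin I Thm. 6.32, §7.1.2). Then the named fact
holds: (H1), (H3), (H4) of `curveNetSaitoData_nonempty_of_hodgeStructures` are supplied by
`HodgeStructureOfHodgeModel` (`HodgeModel.hodgeStructure`) and `HodgeStructureOfHodgeModelSubHodge`
(`mem_map_hodgeStructure_F_of_isInHodgeFiltration`,
`exists_subHodgeStructure_ratClassesSupportedOn_of_model`), (H2) is `hpol`; the weight `↑(m + 1)` of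
`HodgeModel.hodgeStructure` is definitionally the weight `↑m + 1` of the anchor.
[cite: Saito1990, Thm. 0.1–0.2, §2.g and §4.5] [cite: VoisinHodgeI2002, Thm. 6.32, §7.1.1 and §7.1.2]
[cite: VoisinChowRings2014, Thm. 2.39] [cite: DeligneHodgeII1971, Cor. 3.2.17] -/
theorem curveNetSaitoData_nonempty_of_hodgeModels (hI : hodgePQ_independent_of_hodgeModel)
    (hS : ∀ ⦃n : ℕ⦄ ⦃Y : Motives.SchemeOver ℂ⦄, Motives.IsSmoothProjective n Y →
      ∃ A : HodgeModel n Y, A.IsHodgeSymmetric)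
    (hK : ∀ ⦃n : ℕ⦄ ⦃Y : Motives.SchemeOver ℂ⦄, Motives.IsSmoothProjective n Y →
      ∀ (A : HodgeModel n Y) (k : ℕ) (Z : Set Y.left), IsClosed Z →
        (Submodule.span ℂ {x : complexBetti Y k |
            IsRationalClass x ∧ complexBetti.restrictCompl Y Z k x = 0}).map (A.pullback k).hom =
          ⨆ (p : ℕ) (q : ℕ) (_ : p + q = k),
            (Submodule.span ℂ {x : complexBetti Y k |
                IsRationalClass x ∧ complexBetti.restrictCompl Y Z k x = 0}).map
                (A.pullback k).hom ⊓ A.hodgePQ k p q)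
    (hpol : ∀ ⦃n : ℕ⦄ ⦃Y : Motives.SchemeOver ℂ⦄ (hY : Motives.IsSmoothProjective n Y)
      (A : HodgeModel n Y) (hA : A.IsHodgeSymmetric) (k : ℕ), (A.hodgeStructure hY hA k).IsPolarizable) :
    curveNetSaitoData_nonempty := by
  refine curveNetSaitoData_nonempty_of_hodgeStructures fun n Y hY k w hw ↦ ?_
  subst hw
  obtain ⟨A, hA⟩ := hS hY
  exact ⟨A.hodgeStructure hY hA k, hpol hY A hA k,
    fun r c hc ↦ A.mem_map_hodgeStructure_F_of_isInHodgeFiltration hY hI hA k hc,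
    fun Z hZ ↦ A.exists_subHodgeStructure_ratClassesSupportedOn_of_model hY hA k Z (hK hY A k Z hZ)⟩

/-- **`curveNetSaitoData_nonempty` from the named facts `exists_isReal_hodgeModel` and
`hodgePQ_independent_of_hodgeModel`, Deligne's theorem `hK` and the polarizability `hpol`** (a real
Hodge model is Hodge symmetric, `HodgeModel.IsReal.isHodgeSymmetric`). This is the sharpest
reduction of the named fact to inputs the tree already names or has deliberately left as
hypotheses; its discharge `curveNetSaitoData_nonempty_holds` is this theorem fed with theirs.
[cite: Saito1990, Thm. 0.1–0.2, §2.g and §4.5] [cite: VoisinHodgeI2002, Cor. 6.12, Thm. 6.32 and §7.1.1]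
[cite: VoisinChowRings2014, Thm. 2.39] -/
theorem curveNetSaitoData_nonempty_of_exists_isReal_hodgeModel (hR : exists_isReal_hodgeModel)
    (hI : hodgePQ_independent_of_hodgeModel)
    (hK : ∀ ⦃n : ℕ⦄ ⦃Y : Motives.SchemeOver ℂ⦄, Motives.IsSmoothProjective n Y →
      ∀ (A : HodgeModel n Y) (k : ℕ) (Z : Set Y.left), IsClosed Z →
        (Submodule.span ℂ {x : complexBetti Y k |
            IsRationalClass x ∧ complexBetti.restrictCompl Y Z k x = 0}).map (A.pullback k).hom =
          ⨆ (p : ℕ) (q : ℕ) (_ : p + q = k),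
            (Submodule.span ℂ {x : complexBetti Y k |
                IsRationalClass x ∧ complexBetti.restrictCompl Y Z k x = 0}).map
                (A.pullback k).hom ⊓ A.hodgePQ k p q)
    (hpol : ∀ ⦃n : ℕ⦄ ⦃Y : Motives.SchemeOver ℂ⦄ (hY : Motives.IsSmoothProjective n Y)
      (A : HodgeModel n Y) (hA : A.IsHodgeSymmetric) (k : ℕ), (A.hodgeStructure hY hA k).IsPolarizable) :
    curveNetSaitoData_nonempty :=
  curveNetSaitoData_nonempty_of_hodgeModels hI (fun _ _ hY ↦ hR.exists_isHodgeSymmetric hY) hK hpol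

end HodgeTheory

end Literature.AlgebraicGeometry.HodgeTheory

end
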